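import Summits.NavierStokesRegularity.NavierStokesRegularity.Theses.PalasekTowerBreakdown
import Summits.NavierStokesRegularity.FluidComputer.PalasekTowerHeredityWitnessWindowBase

/-!
# NavierStokesRegularity — route `PalasekTowerBreakdown`, item `EpisodeBase`: the WINDOW form by name

Supports `stmt-NavierStokesRegularity-19179` (`EpisodeBase` = K1G `EpisodeBaseG` = `RungG 1`; it does
NOT close it and nobody claims it). Cell `ns-blowup`, seat `ns-blowup-ecbridge-6` (g3; D-0074 GROUP C
«BRIDGE SUPPORT»). LABEL: E–C typing (pure glue, by name on the route decl, over
`FluidComputer/PalasekTowerHeredityWitnessWindowBase.lean`). WHAT THIS IS NOT: not NS — no stage, host,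
flow, tower or blow-up is constructed or asserted; the item is OPEN and appears only inside an
equivalence / as the conclusion of an implication whose hypothesis nobody has discharged.

The base item asks for ONE pinned rigid quiet wide design with a registered stage at level `1`. The
heredity-witness lineage read it in DATUM form (p423427 / p427615
`palasekTowerBreakdown_episodeBase_iff_exists_levelWitness_zero`: a prepared host whose flow, re-run
from `t = 0`, reaches the level-`1` floors at `τ₁`). In WINDOW form nothing before `τ₀ - ε` is re-run:

* `palasekTowerBreakdown_episodeBase_iff_exists_window_solution_zero : PalasekTowerBreakdown.EpisodeBase ↔`
  «some PREPARED HOST (pinned `Λ = 8`, `θ = 6/5`, rigid, quiet, wide; a globally anchored registered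
  stage `s` at level `0` — the class ecbridge-3's `Host.rungG_zero` inhabits) launches from its own
  state `s.u (τ₀ - ε)`, some `0 < ε ≤ τ₀`, ONE WINDOW RUN: a classical solution of the design's forced
  system on `[τ₀ - ε, τ₁]` (window `τ₁ - τ₀ ≈ 1.78·10⁻⁴ = 61.7` strain times), finite energy, below
  `(5/3) Y₁ ≈ 4631` on `[τ₀, τ₁]`, showing at `τ₁`, in the ball, speed `≥ Y₁ ≈ 2778`, gradient
  `≥ A₁ ≈ 1.24·10⁶` and a loop of length `≤ 8π/N₁ ≈ 0.0564` inside a ball of radius `1/N₁ ≈ 2.24·10⁻³`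
  with circulation `≥ N₁^{3/10} ≈ 6.23`» (numbers certified: `PalasekTowerHeredityWitnessCalibration`,
  p432248);
* `palasekTowerBreakdown_episodeBase_of_exists_window_solution_zero` — the entry a construction or a
  certificate would use.

References: S. Palasek, arXiv:2605.13827 §4 [cite: Palasek2026ElementaryModel, §4]; H. Sohr, *The
Navier–Stokes Equations*, Birkhäuser 2001, Ch. V Thm. 1.5.1 [cite: Sohr2001, Ch. V Thm. 1.5.1].
-/

-- `Summit.<Summit>.<Problem>` is the tree's mandated summit-side namespace (CONVENTIONS §2); for this
-- single-conjunct summit the two coincide, so the duplicate is deliberate.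
set_option linter.dupNamespace false

namespace Summit.NavierStokesRegularity.NavierStokesRegularity.Theorems

open Set MeasureTheory
open scoped ENNReal ContDiff
open Literature.Analysis.FluidPDE
open Summit.NavierStokesRegularity.NavierStokesRegularity.Theses
open Summit.NavierStokesRegularity.FluidComputer.PalasekTowerClayBridge

/-- **Item `EpisodeBase` in WINDOW form — no hypothesis**: the route decl holds iff some pinned rigid
quiet wide design with a globally anchored registered level-`0` stage `s` admits, for some
`0 < ε ≤ τ₀`, a classical solution of its forced system on `[τ₀ - ε, τ₁]` from `s.u (τ₀ - ε)`, with
finite energy, below `c₂ Y₁` on `[τ₀, τ₁]`, meeting the three level-`1` floors at `τ₁` (body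
`episodeBaseG_iff_exists_window_solution_zero`). [cite: Sohr2001, Ch. V Thm. 1.5.1] -/
theorem palasekTowerBreakdown_episodeBase_iff_exists_window_solution_zero :
    PalasekTowerBreakdown.EpisodeBase ↔
      ∃ S : Schedule TowerRates.wide, S.Pins 8 (6 / 5) ∧ S.Rigid ∧ S.Quiet ∧
      ∃ s : Stage 1 TowerRates.wide S (Margins.routeG TowerRates.wide) 0,
        ∃ ε : ℝ, 0 < ε ∧ ε ≤ S.τ 0 ∧
        ∃ (v : ℝ → EuclideanSpace ℝ (Fin 3) → EuclideanSpace ℝ (Fin 3))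
          (q : ℝ → EuclideanSpace ℝ (Fin 3) → ℝ),
          IsClassicalNSSolutionOn (Icc (S.τ 0 - ε) (S.τ 1)) 1 S.f v q ∧
          v (S.τ 0 - ε) = s.u (S.τ 0 - ε) ∧
          (∃ C : ℝ≥0∞, C < ⊤ ∧ ∀ t ∈ Icc (S.τ 0 - ε) (S.τ 1), ∫⁻ x, ‖v t x‖ₑ ^ 2 ≤ C) ∧
          (∀ t ∈ Icc (S.τ 0) (S.τ 1), ∀ x, ‖v t x‖ ≤ S.c₂ * TowerRates.wide.Y 1) ∧
          (∃ x, ‖x‖ ≤ S.radius ∧ S.c₁ * TowerRates.wide.Y 1 ≤ ‖v (S.τ 1) x‖) ∧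
          (∃ x, ‖x‖ ≤ S.radius ∧ S.c₁ * TowerRates.wide.A 1 ≤ ‖fderiv ℝ (v (S.τ 1)) x‖) ∧
          (∃ (x : EuclideanSpace ℝ (Fin 3)) (γ : ℝ → EuclideanSpace ℝ (Fin 3)),
            ‖x‖ ≤ S.radius ∧ ContDiff ℝ 1 γ ∧ γ 0 = γ 1 ∧
            (∀ σ ∈ Icc (0 : ℝ) 1, γ σ ∈ Metric.closedBall x (1 / TowerRates.wide.N 1)) ∧
            (∀ σ ∈ Icc (0 : ℝ) 1, ‖deriv γ σ‖ ≤ 8 * Real.pi / TowerRates.wide.N 1) ∧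
            S.c₁ * TowerRates.wide.N 1 ^ (TowerRates.wide.β - 2) ≤ circulation (v (S.τ 1)) γ) := by
  unfold PalasekTowerBreakdown.EpisodeBase
  exact episodeBaseG_iff_exists_window_solution_zero

/-- **The window-run entry for item 19179**: a prepared host plus one window run on `[τ₀ - ε, τ₁]`
from its own state, with the ceiling and the level-`1` floors ⇒ `PalasekTowerBreakdown.EpisodeBase`.
[cite: Sohr2001, Ch. V Thm. 1.5.1] -/
theorem palasekTowerBreakdown_episodeBase_of_exists_window_solution_zero
    (h : ∃ S : Schedule TowerRates.wide, S.Pins 8 (6 / 5) ∧ S.Rigid ∧ S.Quiet ∧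
      ∃ s : Stage 1 TowerRates.wide S (Margins.routeG TowerRates.wide) 0,
        ∃ ε : ℝ, 0 < ε ∧ ε ≤ S.τ 0 ∧
        ∃ (v : ℝ → EuclideanSpace ℝ (Fin 3) → EuclideanSpace ℝ (Fin 3))
          (q : ℝ → EuclideanSpace ℝ (Fin 3) → ℝ),
          IsClassicalNSSolutionOn (Icc (S.τ 0 - ε) (S.τ 1)) 1 S.f v q ∧
          v (S.τ 0 - ε) = s.u (S.τ 0 - ε) ∧
          (∃ C : ℝ≥0∞, C < ⊤ ∧ ∀ t ∈ Icc (S.τ 0 - ε) (S.τ 1), ∫⁻ x, ‖v t x‖ₑ ^ 2 ≤ C) ∧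
          (∀ t ∈ Icc (S.τ 0) (S.τ 1), ∀ x, ‖v t x‖ ≤ S.c₂ * TowerRates.wide.Y 1) ∧
          (∃ x, ‖x‖ ≤ S.radius ∧ S.c₁ * TowerRates.wide.Y 1 ≤ ‖v (S.τ 1) x‖) ∧
          (∃ x, ‖x‖ ≤ S.radius ∧ S.c₁ * TowerRates.wide.A 1 ≤ ‖fderiv ℝ (v (S.τ 1)) x‖) ∧
          (∃ (x : EuclideanSpace ℝ (Fin 3)) (γ : ℝ → EuclideanSpace ℝ (Fin 3)),
            ‖x‖ ≤ S.radius ∧ ContDiff ℝ 1 γ ∧ γ 0 = γ 1 ∧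
            (∀ σ ∈ Icc (0 : ℝ) 1, γ σ ∈ Metric.closedBall x (1 / TowerRates.wide.N 1)) ∧
            (∀ σ ∈ Icc (0 : ℝ) 1, ‖deriv γ σ‖ ≤ 8 * Real.pi / TowerRates.wide.N 1) ∧
            S.c₁ * TowerRates.wide.N 1 ^ (TowerRates.wide.β - 2) ≤ circulation (v (S.τ 1)) γ)) :
    PalasekTowerBreakdown.EpisodeBase :=
  palasekTowerBreakdown_episodeBase_iff_exists_window_solution_zero.2 h

end Summit.NavierStokesRegularity.NavierStokesRegularity.Theorems
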